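import Literature.Computability.Complexity.UniformDerandomizationRSRBridge
import Literature.Computability.Complexity.TVDsrMachine
import Literature.Computability.Complexity.TVHardness
import Literature.Computability.Complexity.UniformDerandomizationEndgame
import HarnessLib

/-!
# Case 2 of Impagliazzo–Wigderson 1998 from an approximate strong construction: `F ∈ BPP`, contradiction

Literature / complexity — derandomization under a uniform assumption (IW98 Thm. 5 / van Melkebeek
Thm. 6.2.1, Case `EXP ⊆ P/poly ∧ BPP ≠ EXP`, in Trevisan–Vadhan's form). The endgame of the printed proof,
assembled from the tree: a strong construction of APPROXIMATE circuits for Trevisan–Vadhan's `F`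
(what IW Lemmas 13–15 / 18–20 produce from a distinguisher of the generator built on `F`) gives, by the
random self-reduction bridge (`UniformDerandomizationRSRBridge.lean`, IW Def. 5), a strong construction
of EXACT circuits; with the downward self-reduction MACHINE of `F` (`TVDsrMachine.lean`:
`TVChk.dsrAlg_run`) the bootstrapping of IW Lemma 16 (`IWBootstrapping.lean`) puts `F` in `BPP`; but `F`'s
language `LTV` is `PSPACE`-hard (`TVHardness.lean`), and under `EXP ⊆ P/poly`, `BPP ≠ EXP` no
`PSPACE`-hard language is in `BPP` (`UniformDerandomizationEndgame.lean`).

* `IWUniform.ofLanguage_LTV` — the oracle of `LTV` answers `[F y]`;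
* **`IWUniform.FB_mem_BPP_of_approx`** — IW Lemma 16 ∘ Def. 5 for `F`: from the approximate strong
  construction (`hA`) and an evaluator `Ev' ∈ FP` meeting the corrector's spec (`hspec`, `hspec0`),
  `{x | F x = 1} ∈ BPP`;
* **`IWUniform.caseTwo_false_of_approx`** — hence, under `EXP ⊆ P/poly` and `BPP ≠ EXP`, such data
  cannot exist: the contradiction that proves Case 2 once the distinguisher-to-construction stages
  supply `hA` for the generator built on `F`.

Everything is proved; no definitions, no named facts.

## References

* [ImpagliazzoWigderson2001] R. Impagliazzo, A. Wigderson, JCSS 63 (2001), Thm. 5, §2.2 Defs. 3–6,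
  Lemmas 15–17.
* [TrevisanVadhan2007] L. Trevisan, S. Vadhan, Comput. Complexity 16 (2007), Lemmas 3.5–3.6, Thm. 4.3.
* [VanMelkebeek2000] D. van Melkebeek, LNCS 1950 (2000), Thm. 6.2.1.
-/

noncomputable section

namespace Literature.Computability.Complexity

namespace IWUniform

open _root_.Computability Polynomial QBFUniv

/-- The oracle of `LTV` answers `[F y]`. [folklore] -/
theorem ofLanguage_LTV (y : List Bool) : Oracle.ofLanguage LTV y = [FB y] := by
  rw [Oracle.ofLanguage, TVChk.boolIndicator_LTV]; rfl

/-- **`F ∈ BPP` from an approximate strong construction** (IW Lemma 16 after Def. 5, for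
Trevisan–Vadhan's `F`). [cite: ImpagliazzoWigderson2001, Lemma 16, Def. 5] [cite: TrevisanVadhan2007, Lemmas 3.5–3.6] -/
theorem FB_mem_BPP_of_approx {Ev Ev' Q G : List Bool → List Bool} (hQ : Q ∈ FP) (hG : G ∈ FP) (q p : Polynomial ℕ)
    (hA : ∀ (k a : ℕ), 1 ≤ a → ∀ O : Oracle, AgreesOn O FB k →
      1 - 1 / (a : ℝ) ≤ uniformProb (p.eval (k + a)) {r | ttFnL Q q G O (strongInput k a r) ∈ approxCircuits Ev FB rsrRho k})
    (hEv' : Ev' ∈ FP)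
    (hspec : ∀ (n i : ℕ), i ≤ mlen n → ∀ (d : List Bool) (a : ℕ) (c w : List Bool), w.length = h n i →
        coinsLen n i a ≤ c.length →
        Ev' (boolPair (boolPair d (boolPair (ones a) c)) w) =
          [majCorrected (descFn Ev d) n (decodeTrials n i (trialsOf (2 * a)) c) w])
    (hspec0 : ∀ (d' w : List Bool), ¬ (ptLen (nOf w.length) + blk (nOf w.length) ≤ w.length - pre (nOf w.length)) →
        Ev' (boolPair d' w) = [false]) :
    {x | FB x = true} ∈ BPP :=
  mem_BPP_of_dsr_of_stronglyConstructible hEv' (stronglyConstructible_circuitsFor_of_ttFnL hQ hG q p hA hspec hspec0)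
    TVChk.dsrAlg_isPolyTime (bM := 2 * X + 1) fun x O hO => by
      have hrun := TVChk.dsrAlg_run x O fun y hy => by rw [hO y hy, ofLanguage_LTV]
      rwa [ofLanguage_LTV] at hrun

/-- **Case 2 of IW98 Thm. 5, the contradiction.** Under `EXP ⊆ P/poly` and `BPP ≠ EXP`, no approximate
strong construction of circuits for `F` (with a corrector evaluator) exists: `F`'s language would be in
`BPP`, yet it is `PSPACE`-hard. [cite: ImpagliazzoWigderson2001, Thm. 5 (Case 2)] [cite: VanMelkebeek2000, Thm. 6.2.1] -/
theorem caseTwo_false_of_approx (hPP : EXP ⊆ PPoly) (hne : BPP ≠ EXP)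
    {Ev Ev' Q G : List Bool → List Bool} (hQ : Q ∈ FP) (hG : G ∈ FP) (q p : Polynomial ℕ)
    (hA : ∀ (k a : ℕ), 1 ≤ a → ∀ O : Oracle, AgreesOn O FB k →
      1 - 1 / (a : ℝ) ≤ uniformProb (p.eval (k + a)) {r | ttFnL Q q G O (strongInput k a r) ∈ approxCircuits Ev FB rsrRho k})
    (hEv' : Ev' ∈ FP)
    (hspec : ∀ (n i : ℕ), i ≤ mlen n → ∀ (d : List Bool) (a : ℕ) (c w : List Bool), w.length = h n i →
        coinsLen n i a ≤ c.length →
        Ev' (boolPair (boolPair d (boolPair (ones a) c)) w) =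
          [majCorrected (descFn Ev d) n (decodeTrials n i (trialsOf (2 * a)) c) w])
    (hspec0 : ∀ (d' w : List Bool), ¬ (ptLen (nOf w.length) + blk (nOf w.length) ≤ w.length - pre (nOf w.length)) →
        Ev' (boolPair d' w) = [false]) : False :=
  not_mem_BPP_of_isHard_PSPACE hPP hne TVHard.isHard_PSPACE_LTV (FB_mem_BPP_of_approx hQ hG q p hA hEv' hspec hspec0)

end IWUniform

end Literature.Computability.Complexity

end
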